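import Literature.Analysis.FluidPDE.ParabolicTenThirds
import Literature.Analysis.FluidPDE.LeiZhang2011SobolevStep
import HarnessLib

/-!
# Lei–Zhang 2011, §2: from the energy inequality to `∬ (ψ f)^{10/3}` (reverse Hölder, part 1)

Analysis/FluidPDE proofs file (theorems only), on the discharge path of the named fact
`Literature.Analysis.FluidPDE.LeiZhang2011_liouville` (Z. Lei, Q. S. Zhang, J. Funct. Anal. 261
(2011) = arXiv:1011.5066, Theorem 1.2 via Theorem 1.1, §2 (2.4)–(2.5)). Two abstract steps of
the Moser iteration, kept free of the equation:

* `LeiZhang2011.sup_le_and_integral_le_of_energy_ineq` — if the energy inequality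
  `η(t) M(t) + ½ ∫_{t₁}^t η G ≤ ∫_{t₁}^t Rm` holds for all `t ∈ [t₁, 0]` with `η, G, M, Rm ≥ 0`
  and `η = 1` on `[−T₂, 0]`, then `sup_{[−T₂,0]} M ≤ ℛ` and `∫_{−T₂}^0 G ≤ 2ℛ`, `ℛ = ∫_{t₁}^0 Rm`
  (p. 7: the left-hand side of (2.4));
* `LeiZhang2011.lintegral_tenThirds_mul_comp_le` — with `g = φ · s_H(F)` (`s_H² = H`,
  `2 s_H'² ≤ H''`), the slice bound `∫ H(F(s)) φ² ≤ ℛ` and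
  `W(s) = ∫ H''(F)‖∇F‖²φ² + 2 ∫ H(F)‖∇φ‖²` give
  `∬ |g|^{10/3} ≤ C_S² ℛ^{2/3} ∫ W` (the Sobolev step, `ParabolicTenThirds`, with the pointwise
  bound `‖∇g‖² ≤ H''(F)‖∇F‖²φ² + 2H(F)‖∇φ‖²` of `LeiZhang2011SobolevStep`).

## References

* Z. Lei, Q. S. Zhang, J. Funct. Anal. 261 (2011) = arXiv:1011.5066, §2 (2.4)–(2.5), p. 7.
  [LeiZhang2011]
-/

noncomputable section

open MeasureTheory Set Function Filter Metric intervalIntegral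
open _root_.Topology
open scoped InnerProductSpace RealInnerProductSpace NNReal ENNReal

namespace Literature.Analysis.FluidPDE

namespace LeiZhang2011

/-- **Consequences of the energy inequality** (Lei–Zhang 2011, left-hand side of (2.4)): if
`η(t) M(t) + ½ ∫_{t₁}^t η G ≤ ∫_{t₁}^t Rm` for every `t ∈ [t₁, 0]`, where `η, M ≥ 0`, `G, Rm ≥ 0`
on `[t₁, 0]` are integrable and `η = 1` on `[−T₂, 0] ⊆ [t₁, 0]`, then
`M(t) ≤ ℛ := ∫_{t₁}^0 Rm` for `t ∈ [−T₂, 0]` and `∫_{−T₂}^0 G ≤ 2ℛ`. [cite: LeiZhang2011, §2 (2.4) (arXiv p. 7)] -/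
theorem sup_le_and_integral_le_of_energy_ineq {t₁ T₂ : ℝ} (ht₁ : t₁ ≤ -T₂) (hT₂ : 0 ≤ T₂)
    {η G M Rm : ℝ → ℝ}
    (hEI : ∀ t ∈ Icc t₁ 0,
      η t * M t + 1 / 2 * ∫ s in t₁..t, η s * G s ≤ ∫ s in t₁..t, Rm s)
    (hη0 : ∀ s, 0 ≤ η s) (hη1 : ∀ s ∈ Icc (-T₂) 0, η s = 1) (hM0 : ∀ s, 0 ≤ M s)
    (hG0 : ∀ s ∈ Icc t₁ 0, 0 ≤ G s) (hRm0 : ∀ s ∈ Icc t₁ 0, 0 ≤ Rm s)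
    (hGi : IntervalIntegrable (fun s => η s * G s) volume t₁ 0)
    (hRmi : IntervalIntegrable Rm volume t₁ 0) :
    (∀ t ∈ Icc (-T₂) 0, M t ≤ ∫ s in t₁..0, Rm s) ∧
      ∫ s in (-T₂)..0, G s ≤ 2 * ∫ s in t₁..0, Rm s := by
  have hT0 : -T₂ ≤ 0 := by linarith
  -- `∫_{t₁}^t Rm ≤ ℛ`
  have hRle : ∀ t ∈ Icc t₁ 0, ∫ s in t₁..t, Rm s ≤ ∫ s in t₁..0, Rm s := by
    intro t ht
    refine integral_mono_interval le_rfl ht.1 ht.2 ?_ hRmi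
    refine (ae_restrict_iff' measurableSet_Ioc).2 (ae_of_all _ fun s hs => ?_)
    exact hRm0 s ⟨hs.1.le, hs.2⟩
  -- `∫_{t₁}^t η G ≥ 0`
  have hGnn : ∀ t ∈ Icc t₁ 0, 0 ≤ ∫ s in t₁..t, η s * G s := by
    intro t ht
    exact intervalIntegral.integral_nonneg ht.1 fun s hs =>
      mul_nonneg (hη0 s) (hG0 s ⟨hs.1, hs.2.trans ht.2⟩)
  refine ⟨fun t ht => ?_, ?_⟩
  · have htI : t ∈ Icc t₁ 0 := ⟨ht₁.trans ht.1, ht.2⟩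
    have h := hEI t htI
    rw [hη1 t ht, one_mul] at h
    linarith [hGnn t htI, hRle t htI]
  · have h0I : (0 : ℝ) ∈ Icc t₁ 0 := ⟨ht₁.trans hT0, le_rfl⟩
    have h := hEI 0 h0I
    have h1 : ∫ s in (-T₂)..0, G s = ∫ s in (-T₂)..0, η s * G s := by
      refine intervalIntegral.integral_congr fun s hs => ?_
      rw [uIcc_of_le hT0] at hs
      simp only [hη1 s hs, one_mul]
    have h2 : ∫ s in (-T₂)..0, η s * G s ≤ ∫ s in t₁..0, η s * G s := by
      refine integral_mono_interval ht₁ hT0 le_rfl ?_ hGi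
      refine (ae_restrict_iff' measurableSet_Ioc).2 (ae_of_all _ fun s hs => ?_)
      exact mul_nonneg (hη0 s) (hG0 s ⟨hs.1.le, hs.2⟩)
    have h3 : 0 ≤ η 0 * M 0 := mul_nonneg (hη0 0) (hM0 0)
    rw [h1]
    linarith

/-- The norm of the gradient is the norm of the Fréchet derivative. [folklore] -/
theorem norm_gradient_eq_norm_fderiv {f : EuclideanSpace ℝ (Fin 3) → ℝ} (x : EuclideanSpace ℝ (Fin 3)) :
    ‖gradient f x‖ = ‖fderiv ℝ f x‖ := by
  rw [gradient, LinearIsometryEquiv.norm_map]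

/-- **The Sobolev step for `g = φ · s_H(F)`** (Lei–Zhang 2011, p. 7, first display of the Moser
step). Let `F(s,·) ∈ C¹`, `H ∈ C²` with `H, H'' ≥ 0`, `s_H ∈ C¹` with `s_H² = H` and
`2 s_H'² ≤ H''`, `φ ∈ C¹_c`. If for `ν`-a.e. `s` the slice bound `∫ H(F(s)) φ² ≤ ℛ` holds and
`W(s) = ∫ H''(F)‖∇F‖²φ² + 2 ∫ H(F)‖∇φ‖²` is `ν`-a.e.-measurable, then
`∬ |φ s_H(F)|^{10/3} d(ν ⊗ dx) ≤ C_S² ℛ^{2/3} ∫ W dν`. [cite: LeiZhang2011, §2 (arXiv p. 7), Sobolev step of the Moser iteration] -/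
theorem lintegral_tenThirds_mul_comp_le {F : ℝ → EuclideanSpace ℝ (Fin 3) → ℝ}
    (hF1 : ∀ s, ContDiff ℝ 1 (F s)) {H sH : ℝ → ℝ} (hH : ContDiff ℝ 2 H) (hH0 : ∀ v, 0 ≤ H v)
    (hH2 : ∀ v, 0 ≤ deriv (deriv H) v) (hsH : ContDiff ℝ 1 sH) (hsH2 : ∀ v, sH v ^ 2 = H v)
    (hsH' : ∀ v, 2 * deriv sH v ^ 2 ≤ deriv (deriv H) v)
    {φ : EuclideanSpace ℝ (Fin 3) → ℝ} (hφ : ContDiff ℝ 1 φ) (hφc : HasCompactSupport φ)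
    {ν : Measure ℝ} {ℛ : ℝ} (hM : ∀ᵐ s ∂ν, ∫ x, H (F s x) * φ x ^ 2 ≤ ℛ)
    {W : ℝ → ℝ} (hWm : AEMeasurable W ν)
    (hW : ∀ s, W s = (∫ x, deriv (deriv H) (F s x) * ‖gradient (F s) x‖ ^ 2 * φ x ^ 2) +
      2 * ∫ x, H (F s x) * ‖gradient φ x‖ ^ 2) :
    ∫⁻ p, ENNReal.ofReal |φ p.2 * sH (F p.1 p.2)| ^ (10 / 3 : ℝ) ∂(ν.prod volume) ≤
      (SNormLESNormFDerivOfEqConst ℝ (volume : Measure (EuclideanSpace ℝ (Fin 3))) 2 : ℝ≥0∞) ^ 2 *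
        ENNReal.ofReal ℛ ^ (2 / 3 : ℝ) * ∫⁻ s, ENNReal.ofReal (W s) ∂ν := by
  -- an opaque name for `g = φ · s_H(F)`
  obtain ⟨g, hg⟩ : ∃ g : ℝ → EuclideanSpace ℝ (Fin 3) → ℝ, ∀ s, g s = fun x => φ x * sH (F s x) :=
    ⟨_, fun _ => rfl⟩
  have hgC : ∀ s, ContDiff ℝ 1 (g s) := fun s => by rw [hg s]; exact hφ.mul (hsH.comp (hF1 s))
  have hgc : ∀ s, HasCompactSupport (g s) := fun s => by rw [hg s]; exact hφc.mul_right
  have hgcont : ∀ s, Continuous (g s) := fun s => (hgC s).continuous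
  have hLHS : (fun p : ℝ × EuclideanSpace ℝ (Fin 3) => ENNReal.ofReal |φ p.2 * sH (F p.1 p.2)| ^ (10 / 3 : ℝ)) =
      fun p => ‖g p.1 p.2‖ₑ ^ (10 / 3 : ℝ) := by
    funext p
    rw [hg p.1, Real.enorm_eq_ofReal_abs]
  rw [hLHS]
  -- continuity of the auxiliary integrands
  have hH'' : Continuous (deriv (deriv H)) := by
    have h2 : ContDiff ℝ (1 + 1) H := by rw [one_add_one_eq_two]; exact hH
    exact h2.deriv'.continuous_deriv le_rfl
  have hgradφ : Continuous (gradient φ) := continuous_gradient_of_contDiff hφ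
  have hφ2c : HasCompactSupport fun y => φ y ^ 2 :=
    hφc.comp_left (g := fun t : ℝ => t ^ 2) (by simp)
  have hgradφc : HasCompactSupport (gradient φ) :=
    HasCompactSupport.intro hφc fun x hx => gradient_eq_zero_of_notMem_tsupport hx
  refine lintegral_rpow_tenThirds_le_of_slice_bounds (g := g) (ν := ν)
    (ae_of_all _ hgC)
    (ae_of_all _ fun s => ((hgcont s).memLp_of_hasCompactSupport (hgc s)).eLpNorm_lt_top)
    (Mstar := ENNReal.ofReal ℛ) ?_ (W := fun s => ENNReal.ofReal (W s))
    (ENNReal.measurable_ofReal.comp_aemeasurable hWm) ?_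
  · -- slice `L²` bound: `∫ ‖g‖ₑ² = ofReal (∫ H(F) φ²) ≤ ofReal ℛ`
    filter_upwards [hM] with s hMs
    have hg2c : HasCompactSupport fun x => g s x ^ 2 :=
      (hgc s).comp_left (g := fun t : ℝ => t ^ 2) (zero_pow two_ne_zero)
    have hint : Integrable (fun x => g s x ^ 2) (volume : Measure (EuclideanSpace ℝ (Fin 3))) :=
      ((hgcont s).pow 2).integrable_of_hasCompactSupport hg2c
    have h1 : ∫⁻ x, ‖g s x‖ₑ ^ 2 = ENNReal.ofReal (∫ x, g s x ^ 2) := by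
      rw [ofReal_integral_eq_lintegral_ofReal hint (ae_of_all _ fun x => sq_nonneg _)]
      refine lintegral_congr fun x => ?_
      rw [Real.enorm_eq_ofReal_abs, ← ENNReal.ofReal_pow (abs_nonneg _), sq_abs]
    rw [h1]
    refine ENNReal.ofReal_le_ofReal (le_trans (le_of_eq (integral_congr_ae (ae_of_all _ fun x => ?_))) hMs)
    show g s x ^ 2 = H (F s x) * φ x ^ 2
    rw [hg s]
    simp only [mul_pow, hsH2]
    ring
  · -- slice gradient bound
    filter_upwards with s
    set w : EuclideanSpace ℝ (Fin 3) → ℝ := fun x =>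
      deriv (deriv H) (F s x) * ‖gradient (F s) x‖ ^ 2 * φ x ^ 2 + 2 * H (F s x) * ‖gradient φ x‖ ^ 2
      with hw
    have hgradF : Continuous (gradient (F s)) := continuous_gradient_of_contDiff (hF1 s)
    have hw1c : Continuous fun x => deriv (deriv H) (F s x) * ‖gradient (F s) x‖ ^ 2 * φ x ^ 2 :=
      ((hH''.comp (hF1 s).continuous).mul (hgradF.norm.pow 2)).mul (hφ.continuous.pow 2)
    have hw2c : Continuous fun x => H (F s x) * ‖gradient φ x‖ ^ 2 :=
      (hH.continuous.comp (hF1 s).continuous).mul (hgradφ.norm.pow 2)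
    have hw1i : Integrable (fun x => deriv (deriv H) (F s x) * ‖gradient (F s) x‖ ^ 2 * φ x ^ 2)
        (volume : Measure (EuclideanSpace ℝ (Fin 3))) :=
      hw1c.integrable_of_hasCompactSupport hφ2c.mul_left
    have hw2i : Integrable (fun x => H (F s x) * ‖gradient φ x‖ ^ 2)
        (volume : Measure (EuclideanSpace ℝ (Fin 3))) :=
      hw2c.integrable_of_hasCompactSupport ((hgradφc.norm.comp_left (g := fun t : ℝ => t ^ 2) (by simp)).mul_left)
    have hwi : Integrable w (volume : Measure (EuclideanSpace ℝ (Fin 3))) := by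
      have := hw1i.add (hw2i.const_mul 2)
      refine this.congr (ae_of_all _ fun x => ?_)
      simp only [hw, Pi.add_apply]
      ring
    have hw0 : ∀ x, 0 ≤ w x := fun x =>
      add_nonneg (mul_nonneg (mul_nonneg (hH2 _) (sq_nonneg _)) (sq_nonneg _))
        (mul_nonneg (mul_nonneg zero_le_two (hH0 _)) (sq_nonneg _))
    -- pointwise bound
    have hpt : ∀ x, ‖fderiv ℝ (g s) x‖ ^ 2 ≤ w x := fun x => by
      rw [← norm_gradient_eq_norm_fderiv, hg s]
      have h := norm_gradient_mul_comp_sq_le' (hF1 s) hsH hsH' hφ x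
      simp only [hw, hsH2] at h ⊢
      linarith
    calc ∫⁻ x, ‖fderiv ℝ (g s) x‖ₑ ^ 2
        ≤ ∫⁻ x, ENNReal.ofReal (w x) := by
          refine lintegral_mono fun x => ?_
          rw [← ofReal_norm, ← ENNReal.ofReal_pow (norm_nonneg _)]
          exact ENNReal.ofReal_le_ofReal (hpt x)
      _ = ENNReal.ofReal (∫ x, w x) := (ofReal_integral_eq_lintegral_ofReal hwi (ae_of_all _ hw0)).symm
      _ = ENNReal.ofReal (W s) := by
          congr 1
          rw [hW s, ← MeasureTheory.integral_const_mul, ← integral_add hw1i (hw2i.const_mul 2)]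
          refine integral_congr_ae (ae_of_all _ fun x => ?_)
          simp only [hw]
          ring

end LeiZhang2011

end Literature.Analysis.FluidPDE
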